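import Literature.Computability.Complexity.Mod2TseitinReduction
import Literature.Computability.Complexity.TseitinGraphOfRotGraph
import Literature.Computability.Complexity.ExpanderFamily
import HarnessLib

/-!
# Grigoriev's linear SOS degree lower bound for `MOD2_n` — proof of the named fact
# `Grigoriev2001_mod2Degree` (Grigoriev 2001, Corollary 2)

This file DISCHARGES the named fact `Literature.Computability.Complexity.Grigoriev2001_mod2Degree`
of `Mod2SosDegree.lean` ("the degree of any `PC>` refutation of `MOD2_k` is greater than `Ω(k)`",
Theoret. Comput. Sci. 259 (2001), Cor. 2, p. 622, in the tree's static sum-of-squares form):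
there are `c > 0` and `n₀` with `c · n ≤ 2 d` whenever `HasSOSRefutation (Mod2.system n) d` and
`n ≥ n₀`.

The proof is Grigoriev's (§3, Lemma 10 + Lemma 9 + the Theorem of §2), assembled from:

* the explicit constant-degree expander family `Expander.Family.XN m` of the tree
  (`ExpanderFamily.lean`: `Nx m` vertices, `m ≤ Nx m ≤ B m`, degree `dX`, `λ ≤ 1/10`) in place of
  the Lubotzky–Phillips–Sarnak / Margulis graphs of the paper;
* `TseitinGraphOfRotGraph.lean`: its loop-free multigraph `LGraph.ofRot`, degrees `≤ dX`, and
  BOUNDARY EXPANSION `IsBoundaryExpander _ (Nx m / 2) (dX (1 - 1/10) / 2)` from the spectral bound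
  (Arora–Barak (22.1)), hence vector expansion of the Tseitin scopes
  (`vecExpands_of_isBoundaryExpander`) — the hypothesis of the Grigoriev–Schoenebeck pseudo-moments;
* `Mod2TseitinReduction.lean`: `Mod2Gadget.not_hasSOSRefutation_mod2` — `MOD2_N`,
  `N = Σ_v (1 + 2 deg v) + 2 npad`, has no static SOS refutation of half-degree `d'` when
  `(2 d' + 2) dX ≤ ⌊c r / 2⌋`;
* parity and padding: `Nx m = B^{…}` is ODD (`B = 631^16`), so `N` runs through all large odd
  numbers as `npad` varies (`odd_base`, `exists_npad`); for EVEN `n` the system `MOD2_n` is satisfiable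
  (`Mod2.exists_common_zero_of_even`) and has no refutation at all (`HasSOSRefutation.no_common_zero`).

The constant obtained is `c = 9 / (160 K)`, `K = B (1 + 2 dX)`, threshold `n₀ = 56 K` — tiny but
positive, as the fact only records `∃ c > 0`.

## References

* D. Grigoriev, *Linear lower bound on degrees of Positivstellensatz calculus proofs for the
  parity*, Theoret. Comput. Sci. 259 (2001) 613–622, §3, Lemma 10, Corollary 2. [Grigoriev2001TCS]
* S. Arora, B. Barak, *Computational Complexity: A Modern Approach*, CUP 2009, Thm. 21.19,
  eq. (22.1). [AroraBarakCC2009]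
-/

noncomputable section

open Finset
open Literature.Computability.MetaComplexity

namespace Literature.Computability.Complexity

namespace Grigoriev2001

open Expander Expander.Family Mod2Gadget

/-! ### Parity of the expander sizes -/

/-- `q = 631` is odd. [cite: AroraBarakCC2009, Thm. 21.19 (sizes of the explicit expander family)] -/
theorem odd_qb : Odd qb := by unfold qb; exact ⟨315, by norm_num⟩

/-- `D = q⁴` is odd. [cite: AroraBarakCC2009, Thm. 21.19 (sizes of the explicit expander family)] -/
theorem odd_D : Odd D := by unfold D; exact (odd_qb.mul odd_qb).mul (odd_qb.mul odd_qb)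

/-- `B = D⁴` is odd. [cite: AroraBarakCC2009, Thm. 21.19 (sizes of the explicit expander family)] -/
theorem odd_B : Odd B := by unfold B; exact (odd_D.mul odd_D).pow

/-- The expander sizes `Nx m = B^(log_B m + 1)` are odd. [cite: AroraBarakCC2009, Thm. 21.19 (sizes of the explicit expander family)] -/
theorem odd_Nx (m : ℕ) : Odd (Nx m) := by rw [Nx, N_eq]; exact odd_B.pow

/-- `Nx m > 0`. [cite: AroraBarakCC2009, Thm. 21.19 (sizes of the explicit expander family)] -/
theorem Nx_pos (m : ℕ) : 0 < Nx m := (odd_Nx m).pos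

/-! ### The Tseitin graphs of the reduction -/

/-- **The graphs `G_m`**: the loop-free multigraph of the expander `XN m` (`Nx m` vertices,
degree `≤ dX`, `λ ≤ 1/10`). [cite: Grigoriev2001TCS, §3 (the expanders G_k, "one could take r = 6")] -/
abbrev graph (m : ℕ) : LGraph (Fin (Nx m)) := LGraph.ofRot (XN m) (Nx_pos m) dX_pos

/-- The number of points of the reduction WITHOUT padding: `Σ_v (1 + 2 deg v)`.
[cite: Grigoriev2001TCS, Lemma 10 ("MOD2_{k(1+2r)}")] -/
def base (m : ℕ) : ℕ := ∑ v : Fin (Nx m), (1 + 2 * ((graph m).star v).card)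

/-- The size constant `K = B (1 + 2 dX)`: `base m ≤ K m`. [cite: Grigoriev2001TCS, Lemma 10] -/
def K : ℕ := B * (1 + 2 * dX)

/-- `K > 0`. [cite: Grigoriev2001TCS, Lemma 10 ("MOD2_{k(1+2r)}")] -/
theorem K_pos : 0 < K := Nat.mul_pos (lt_of_lt_of_le Nat.zero_lt_two two_le_B) (Nat.succ_pos _)

/-- `base m ≤ Nx m (1 + 2 dX)`. [cite: Grigoriev2001TCS, Lemma 10 ("MOD2_{k(1+2r)}")] -/
theorem base_le_Nx_mul (m : ℕ) : base m ≤ Nx m * (1 + 2 * dX) := by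
  unfold base
  calc ∑ v : Fin (Nx m), (1 + 2 * ((graph m).star v).card)
      ≤ ∑ _v : Fin (Nx m), (1 + 2 * dX) :=
        sum_le_sum fun v _ => by
          have : ((graph m).star v).card ≤ dX := LGraph.card_star_ofRot_le v
          omega
    _ = Nx m * (1 + 2 * dX) := by rw [sum_const, card_univ, Fintype.card_fin, smul_eq_mul]

/-- `base m ≤ K m` for `m ≥ 1`. [cite: Grigoriev2001TCS, Lemma 10] -/
theorem base_le (m : ℕ) (hm : 0 < m) : base m ≤ K * m := by
  refine (base_le_Nx_mul m).trans ?_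
  rw [K, mul_right_comm]
  exact Nat.mul_le_mul_right _ (Nx_le hm)

/-- `base m` is odd (it is `Nx m` plus twice the number of edge-point pairs).
[cite: Grigoriev2001TCS, Lemma 10] -/
theorem odd_base (m : ℕ) : Odd (base m) := by
  unfold base
  rw [sum_add_distrib, sum_const, card_univ, Fintype.card_fin, smul_eq_mul, mul_one, ← mul_sum]
  exact (odd_Nx m).add_even (even_two_mul _)

/-- The number of points of the padded reduction is `base m + 2 npad`.
[cite: Grigoriev2001TCS, Lemma 10] -/
theorem card_pt_graph (m npad : ℕ) :
    Fintype.card (Pt (graph m) npad) = base m + 2 * npad :=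
  card_pt

/-- **Padding**: every odd `n ≥ base m` is the number of points of some padded reduction.
[cite: Grigoriev2001TCS, Lemma 10 with Cor. 2 (all odd sizes)] -/
theorem exists_npad {m n : ℕ} (hn : Odd n) (hle : base m ≤ n) : ∃ npad, base m + 2 * npad = n := by
  obtain ⟨k, hk⟩ := hn
  obtain ⟨j, hj⟩ := odd_base m
  refine ⟨k - j, ?_⟩
  omega

/-! ### The degree bound for one graph -/

/-- **Grigoriev's bound on the graph `G_m`** (`m ≥ 4`): if `MOD2` on the padded reduction of
`G_m` has a static SOS refutation of half-degree `d'`, then `2 d' > 9 m / 80 - 3`. From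
`Mod2Gadget.not_hasSOSRefutation_mod2` with `r = Nx m / 2`, `c = dX (1 - 1/10)/2`, `Δ = dX`,
`d = ⌊c r / 2⌋`: a refutation forces `(2 d' + 2) dX > d`. [cite: Grigoriev2001TCS, Cor. 2 (proof)] -/
theorem bound_of_hasSOSRefutation {m : ℕ} (hm : 4 ≤ m) {npad d' : ℕ}
    (h : HasSOSRefutation (Mod2.system (base m + 2 * npad)) d') :
    (9 : ℝ) * m / 80 - 3 < 2 * d' := by
  have hbd := LGraph.isBoundaryExpander_ofRot (Nx_pos m) dX_pos (spectralBound_XN m)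
  have hexp := vecExpands_of_isBoundaryExpander hbd
  have hdX0 : (0 : ℝ) < dX := by exact_mod_cast dX_pos
  have hc : (0 : ℝ) < dX * (1 - 1 / 10) / 2 := by positivity
  have hmN : (m : ℝ) ≤ Nx m := by exact_mod_cast le_Nx m
  have hr : (2 : ℝ) ≤ (Nx m : ℝ) / 2 := by
    have : (4 : ℝ) ≤ m := by exact_mod_cast hm
    linarith
  have hΔ : ∀ v, ((graph m).star v).card ≤ dX := fun v => LGraph.card_star_ofRot_le v
  set d : ℕ := ⌊dX * (1 - 1 / 10) / 2 * ((Nx m : ℝ) / 2) / 2⌋₊ with hd_def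
  have hd : (d : ℝ) ≤ dX * (1 - 1 / 10) / 2 * ((Nx m : ℝ) / 2) / 2 := Nat.floor_le (by positivity)
  have key : ¬ (2 * d' + 2) * dX ≤ d := by
    intro hd'
    have := not_hasSOSRefutation_mod2 (G := graph m) (npad := npad) hexp hc hr hΔ hd hd'
    rw [card_pt_graph] at this
    exact this h
  have hlt : d + 1 ≤ (2 * d' + 2) * dX := not_le.1 key
  have h1 : dX * (1 - 1 / 10) / 2 * ((Nx m : ℝ) / 2) / 2 < d + 1 := Nat.lt_floor_add_one _
  have h2 : (d : ℝ) + 1 ≤ (2 * d' + 2) * dX := by exact_mod_cast hlt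
  have hdX1 : (1 : ℝ) ≤ dX := by exact_mod_cast dX_pos
  have h3 : 9 * (Nx m : ℝ) / 80 * dX < (2 * d' + 3) * dX := by nlinarith
  have h4 : 9 * (Nx m : ℝ) / 80 < 2 * d' + 3 := lt_of_mul_lt_mul_right h3 hdX0.le
  linarith

/-! ### The named fact -/

/-- **Grigoriev 2001, Corollary 2 — proof of the tree's named fact `Grigoriev2001_mod2Degree`.**
With `c = 9 / (160 K)` and `n₀ = 56 K` (`K = B (1 + 2 dX)`): for every `n ≥ n₀` and every static
sum-of-squares refutation of `MOD2_n` of half-degree `d`, `c · n ≤ 2 d`. Even `n`: `MOD2_n` is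
satisfiable, so there is no refutation (soundness). Odd `n`: `n = base m + 2 npad` for
`m = ⌊n / K⌋ ≥ 56`, and `bound_of_hasSOSRefutation` gives `2 d > 9 m / 80 - 3 ≥ c n`.
[cite: Grigoriev2001TCS, Cor. 2 (p. 622)] -/
theorem grigoriev2001_mod2Degree_holds : Grigoriev2001_mod2Degree := by
  have hK := K_pos
  have hKr : (0 : ℝ) < K := by exact_mod_cast hK
  refine ⟨9 / (160 * K), by positivity, 56 * K, fun n hn d' hS => ?_⟩
  rcases Nat.even_or_odd n with hev | hodd
  · -- even `n`: vacuous
    obtain ⟨x, hx⟩ := Mod2.exists_common_zero_of_even hev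
    obtain ⟨ι, hι⟩ := hS.no_common_zero x
    exact absurd (hx ι) hι
  · -- odd `n`
    obtain ⟨m, hm⟩ : ∃ m, m = n / K := ⟨_, rfl⟩
    have hm56 : 56 ≤ m := by rw [hm]; exact (Nat.le_div_iff_mul_le hK).2 hn
    have hmK : m * K ≤ n := by rw [hm]; exact Nat.div_mul_le_self n K
    have hlt : n < m * K + K := by rw [hm]; exact Nat.lt_div_mul_add hK
    have hbase : base m ≤ n := (base_le m (by omega)).trans (by rw [mul_comm]; exact hmK)
    obtain ⟨npad, hnpad⟩ := exists_npad hodd hbase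
    rw [← hnpad] at hS
    have hb := bound_of_hasSOSRefutation (by omega) hS
    -- arithmetic: `9 m / 80 - 3 < 2 d'`, `n < (m + 1) K`, `56 K ≤ n` ⟹ `9 n / (160 K) ≤ 2 d'`
    have hx1 : (n : ℝ) / K - 1 ≤ m := by
      rw [sub_le_iff_le_add, div_le_iff₀ hKr]
      exact_mod_cast (by linarith : n ≤ (m + 1) * K)
    have hx2 : (56 : ℝ) ≤ (n : ℝ) / K := by
      rw [le_div_iff₀ hKr]
      exact_mod_cast hn
    have : (9 : ℝ) / (160 * K) * n = 9 / 160 * ((n : ℝ) / K) := by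
      field_simp
    rw [this]
    linarith

end Grigoriev2001

/-- **Grigoriev 2001, Corollary 2** (`Grigoriev2001_mod2Degree`, now a theorem): SOS needs degree
`Ω(n)` to refute "`K_n` has a perfect matching". [cite: Grigoriev2001TCS, Cor. 2 (p. 622)] -/
theorem Grigoriev2001_mod2Degree_holds : Grigoriev2001_mod2Degree :=
  Grigoriev2001.grigoriev2001_mod2Degree_holds

end Literature.Computability.Complexity
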